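import Mathlib
import Summits.RiemannHypothesis.RiemannHypothesis.Theorems.WeilFarFloorCoshGapRateRH
import Summits.RiemannHypothesis.RiemannHypothesis.Theorems.WeilFarFloorCoshZeroSum
import Summits.RiemannHypothesis.RiemannHypothesis.Theorems.WeilFarFloorLawThreshold
import HarnessLib

/-!
# Under RH the residual of the floor law C-XIII IS minus the zero sum: `ε(a) + Z(a) → 0`

Helper file (`--supports stmt-RiemannHypothesis-0098`, lead-track anchor: Weil-positivity window ladder, format-C far bound),
pure proofs.  Seat rh-explicit-weil-1 gen13 (memo `run/shared/lean/pub/rh-explicit/rh-explicit-weil-1/FORMAT-K3.md` §14.4).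

STRUCTURE.md law C-XIII reads `λ_max(a) = pntFloor a − 2γ_E + ε(a)`.  The sealed numerical finding PREREG-FLOOR-RESIDUAL-ZEROSUM
(FORMAT-K3 §11.12, blind) was `ε(a) ≈ −Z(a)`, `Z(a) = Re(Σ_ρ m(ρ)e^{2aρ}/ρ²)/(2(a + sinh a))` the parameter-free sum over the non-trivial zeros.
This file makes it a THEOREM UNDER RH:

  **`RiemannHypothesis → λ_max(a) − (pntFloor a − 2γ_E) + Z(a) → 0`**   (`tendsto_farFloorDiscrepancy_add_zeroSum_of_RH`),

by adding C-XIII″ (`WeilFarFloorCoshGapRateRH.tendsto_farCoercivityFloor_sub_coshQuotient_of_RH`: `λ_max(a) − R_c(a) → 0` under RH) to the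
UNCONDITIONAL cosh-test asymptotics `R_c(a) − (pntFloor a − 2γ_E) + Z(a) → 0` (`WeilFarFloorCoshZeroSum.tendsto_coshSum_div_sub_pntFloor`, with
`R_c(a) = S(a)/(a + sinh a)` by `FloorCosh.primeShiftForm_coshTest`).  Corollary: under RH, for every `ε > 0`, eventually
`|λ_max(a) − (pntFloor a − 2γ_E)| ≤ β + ε` with `β = 2 + γ − log 4π` (`abs_zeroSum_div_le_of_RH`) — the floor law with the sharp two-sided
constant, by a route independent of `WeilFarFloorLawSharpRH`.  Standard axioms only; RH enters as Mathlib's `RiemannHypothesis`.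
-/

set_option linter.dupNamespace false
set_option autoImplicit false

noncomputable section

open MeasureTheory Set Filter Topology
open scoped Real ArithmeticFunction.vonMangoldt

namespace Summit.RiemannHypothesis.RiemannHypothesis.Theorems.WeilFormatC

namespace FloorCoshSplit

open Literature.NumberTheory.LFunctions FloorCosh FloorCoshZeroSum NicolasJExplicit

/-- **UNDER RH THE FLOOR RESIDUAL IS MINUS THE ZERO SUM**:
`λ_max(a) − (pntFloor a − 2γ_E) + Re(Σ_ρ m(ρ)e^{2aρ}/ρ²)/(2(a + sinh a)) → 0` as `a → ∞`. -/
theorem tendsto_farFloorDiscrepancy_add_zeroSum_of_RH (hRH : RiemannHypothesis) :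
    Tendsto (fun a : ℝ ↦ farCoercivityFloor a - (pntFloor a - 2 * Real.eulerMascheroniConstant)
      + ((∑' ρ : Zeros, (riemannZetaZeroOrder (ρ : ℂ) : ℂ) * ((((Real.exp (2 * a) : ℝ)) : ℂ) ^ (ρ : ℂ) / (ρ : ℂ) ^ 2))).re
          / (2 * (a + Real.sinh a))) atTop (𝓝 0) := by
  have h1 := tendsto_farCoercivityFloor_sub_coshQuotient_of_RH hRH
  have h2 := tendsto_coshSum_div_sub_pntFloor
  have h := h1.add h2
  rw [add_zero] at h
  refine h.congr' (Eventually.of_forall fun a ↦ ?_)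
  simp only [primeShiftForm_coshTest a]
  ring

/-- **UNDER RH, the floor to `o(1)` in closed form**: `λ_max(a) − (e^a + 2a − 2 − 2γ_E) + Z(a) → 0`
(`pntFloor a = e^a + 2a − 2 + O(a²e^{−a})`, `WeilFarFloorMainTermExact`). -/
theorem tendsto_farCoercivityFloor_sub_exp_add_zeroSum_of_RH (hRH : RiemannHypothesis) :
    Tendsto (fun a : ℝ ↦ farCoercivityFloor a - (Real.exp a + 2 * a - 2 - 2 * Real.eulerMascheroniConstant)
      + ((∑' ρ : Zeros, (riemannZetaZeroOrder (ρ : ℂ) : ℂ) * ((((Real.exp (2 * a) : ℝ)) : ℂ) ^ (ρ : ℂ) / (ρ : ℂ) ^ 2))).re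
          / (2 * (a + Real.sinh a))) atTop (𝓝 0) := by
  have h1 := tendsto_farCoercivityFloor_sub_coshQuotient_of_RH hRH
  have h2 := tendsto_coshSum_div
  have h := h1.add h2
  rw [add_zero] at h
  refine h.congr' (Eventually.of_forall fun a ↦ ?_)
  simp only [primeShiftForm_coshTest a]
  ring

/-- **UNDER RH, THE FLOOR LAW WITH THE SHARP TWO-SIDED CONSTANT**: for every `ε > 0`, eventually
`|λ_max(a) − (pntFloor a − 2γ_E)| ≤ β + ε`, `β = 2 + γ − log 4π = Σ_ρ m(ρ)/|ρ|²`. -/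
theorem eventually_abs_farFloorDiscrepancy_le_beta_of_RH (hRH : RiemannHypothesis) {ε : ℝ} (hε : 0 < ε) :
    ∀ᶠ a : ℝ in atTop, |farCoercivityFloor a - (pntFloor a - 2 * Real.eulerMascheroniConstant)| ≤ nicolasBeta + ε := by
  have h := (Metric.tendsto_nhds.1 (tendsto_farFloorDiscrepancy_add_zeroSum_of_RH hRH)) ε hε
  filter_upwards [h, Filter.eventually_ge_atTop (1 : ℝ)] with a ha ha1
  rw [Real.dist_eq, sub_zero] at ha
  have hZ := abs_zeroSum_div_le_of_RH hRH ha1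
  have := abs_add_le (farCoercivityFloor a - (pntFloor a - 2 * Real.eulerMascheroniConstant)
    + ((∑' ρ : Zeros, (riemannZetaZeroOrder (ρ : ℂ) : ℂ) * ((((Real.exp (2 * a) : ℝ)) : ℂ) ^ (ρ : ℂ) / (ρ : ℂ) ^ 2))).re
        / (2 * (a + Real.sinh a)))
    (-(((∑' ρ : Zeros, (riemannZetaZeroOrder (ρ : ℂ) : ℂ) * ((((Real.exp (2 * a) : ℝ)) : ℂ) ^ (ρ : ℂ) / (ρ : ℂ) ^ 2))).re
        / (2 * (a + Real.sinh a))))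
  rw [abs_neg, add_neg_cancel_right] at this
  linarith

/-- **UNDER RH, C-XIII HOLDS** (the discrepancy predicate from `a₀ = 1` with some constant). -/
theorem exists_farFloorDiscrepancyLe_of_RH (hRH : RiemannHypothesis) : ∃ C, FarFloorDiscrepancyLe C 1 :=
  FloorLaw.exists_farFloorDiscrepancyLe_of_eventually (eventually_abs_farFloorDiscrepancy_le_beta_of_RH hRH one_pos)

end FloorCoshSplit

end Summit.RiemannHypothesis.RiemannHypothesis.Theorems.WeilFormatC
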